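import Summits.QuantumFields.YangMills.Theorems.SwapVirialDeficitGnomonicTaylorLine
import Summits.QuantumFields.YangMills.Theorems.SwapVirialDeficitBlowUpGnomonicHubShiftSmooth
import HarnessLib

/-!
# W4, part K7d: JETS ALONG JOINT HUB–LETTER LINES — the hub-polar deviation `δ` as one more gnomonic letter
# (free-hands support of ⟨stmt-QuantumFields-24197⟩ `SwapVirialDeficit.SwapGluedStiffness`; cell ym-idea-1, ➎ plan of record memo7 §E(3)(5): the B-tube and
# sector-001 fibres contain the hub direction `δ` (w2 g59 2026-08-31 19:44Z request: «without it the B∕001 cubic data (A₃) do not exist»))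

K7a∕K7b (✓`jet4_leader_line`, ✓`realJet4_gnoDeficit_line_le`, ✓`taylor_four_gnoDeficit_line`) give the 4-jet of `s ↦ F̂_{a,ε}(η + sξ)` at a FIXED hub `a`.  In the B-region and
in sector 001 the hub moves too, along w3 g66's shift `a(s) = a − (sδ₁)·1` (✓`contDiff_gnoDeficit_hubShift`; `im a(s) = im a`, ✓`im_sub_smul_one`;
`axisPoint a(s) = axisPoint a − (sδ₁)·1`, ✓`axisPoint_sub_smul_one`).  The hub enters the leaders only through the unit `A(s) = radialUnit (axisPoint a(s))`
(leader 3, and the slaving `C₁ = Ā x̂ A ẑ`); `s ↦ axisPoint a(s)` is an affine line whose foot has `imI`-component `‖im a‖`, so ✓`jet4_radialUnit_line` gives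
`A` a 4-jet of size `|δ₁|∕‖im a‖` (§1 `jet4_hubAxis_line`).  The rest is K7b verbatim:

* §1 ★ `jet4_hubAxis_line`;  §2 ★★ `jet4_leader_hubLine` (every leader: size `2|δ₁|∕‖im a‖ + Σ letter sizes`), `jet4_follower_hubLine` (hub-free);
* §3 ★★ `realJet4_gnoDeficit_hubLine_le`, ★★★ `taylor_four_gnoDeficit_hubLine` — for `ψ(s) = F̂_{a − (sδ₁)·1, ε}(η + sξ)` with `|δ₁| ≤ S‖im a‖` and all letter sizes
  `≤ S`: `|ψ′| ≤ 1008L⁴S`, `|ψ″| ≤ 39984L⁴S²`, `|ψ‴| ≤ 6816096L⁴S³`, `|ψ⁗| ≤ 1464571584L⁴S⁴` everywhere, and the two Taylor remainders at `s = 0`.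

HONEST LABEL: calculus plumbing (no measure); nothing about ⟨24197⟩ ∕ ⟨24194⟩ (OPEN) is proved; ⟨24196⟩ proved elsewhere; item of record ⟨24085⟩ SubOctaveBounded aside ∕
untouched; the Yang–Mills mass gap is NOT proved; no summit is proved by a line.  THEOREMS ONLY (0 `def`, 0 `sorry`), standard axioms, no local instances.
Seat ym-line-fcl-p3 g47 (cell ym-idea-1, free hands), `--supports stmt-QuantumFields-24197`.  References: [cite: Luscher1983, §2]; [folklore].
-/

set_option autoImplicit false

noncomputable section

open Quaternion Set
open scoped Quaternion RealInnerProductSpace BigOperators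
open Literature.MathematicalPhysics.QuantumLattice
open Literature.MathematicalPhysics.QuantumFieldTheory hiding SU2
open Literature.Analysis.Calculus (radialUnit radialUnit_def norm_radialUnit)
open Summit.QuantumFields.YangMills.Theorems.FemtoTransferGap
open Summit.QuantumFields.YangMills.Theorems.FemtoTransferGap.TT
open Summit.QuantumFields.YangMills.Theorems.SwapTwistDeficit.ToronLog (axisPoint)
open Summit.QuantumFields.YangMills.Theorems.SwapVirialDeficit.ZeroModeSigma (su2Quat_quatToSU2_eq_radialUnit slaveP norm_axisUnit dil3 dil3_apply)
open Summit.QuantumFields.YangMills.Theorems.SwapVirialDeficit.BlowUp (leaderTuple dil3_one' dilateIm_one_apply qDeficit swapRingDeficit_eq_qDeficit)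
open Summit.QuantumFields.YangMills.Theorems.SwapVirialDeficit.BlowUpRing

namespace Summit.QuantumFields.YangMills.Theorems.SwapVirialDeficit.Gnomonic

variable {L : ℕ} [NeZero L]

/-! ## §1 The hub unit along the shift `a − (sδ₁)·1` -/

omit [NeZero L] in
/-- ★ **THE HUB UNIT CARRIES A 4-JET OF SIZE `|δ₁|∕‖im a‖`** along `s ↦ a − (sδ₁)·1` (`im a ≠ 0`): `axisPoint` moves on the affine line `axisPoint a − (sδ₁)·1`
whose foot of the perpendicular from `0` has `imI`-component `‖im a‖` (✓`jet4_radialUnit_line`). [folklore] -/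
theorem jet4_hubAxis_line {a : ℍ} (ha : a.im ≠ 0) (δ₁ : ℝ) :
    ∃ f₁ f₂ f₃ f₄ : ℝ → ℍ, (∀ s, HasDerivAt (fun s : ℝ => radialUnit (axisPoint (a - (s * δ₁) • (1 : ℍ)))) (f₁ s) s) ∧ (∀ s, HasDerivAt f₁ (f₂ s) s) ∧
      (∀ s, HasDerivAt f₂ (f₃ s) s) ∧ (∀ s, HasDerivAt f₃ (f₄ s) s) ∧
      ∀ s, ‖radialUnit (axisPoint (a - (s * δ₁) • (1 : ℍ)))‖ ≤ 1 ∧ ‖f₁ s‖ ≤ |δ₁| / ‖a.im‖ ∧ ‖f₂ s‖ ≤ (|δ₁| / ‖a.im‖) ^ 2 ∧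
        ‖f₃ s‖ ≤ 3 * (|δ₁| / ‖a.im‖) ^ 3 ∧ ‖f₄ s‖ ≤ 9 * (|δ₁| / ‖a.im‖) ^ 4 := by
  set u₀ : ℍ := axisPoint a with hu₀
  set w : ℍ := (-δ₁) • (1 : ℍ) with hw
  have hn : 0 < ‖a.im‖ := norm_pos_iff.2 ha
  -- the line
  have eline : ∀ s : ℝ, axisPoint (a - (s * δ₁) • (1 : ℍ)) = u₀ + s • w := fun s => by
    rw [axisPoint_sub_smul_one, hu₀, hw, smul_smul, sub_eq_add_neg, ← neg_smul, show -(s * δ₁) = s * -δ₁ by ring]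
  -- the foot has `imI`-component `‖im a‖`
  set c : ℝ := -(⟪u₀, w⟫ / ‖w‖ ^ 2) with hc
  have hfootI : (u₀ + c • w).imI = ‖a.im‖ := by
    simp [hu₀, hw, axisPoint]
  have hfoot_norm : ‖a.im‖ ≤ ‖u₀ + c • w‖ := by
    have h1 : ‖a.im‖ ^ 2 ≤ ‖u₀ + c • w‖ ^ 2 := by
      have e : ‖u₀ + c • w‖ ^ 2 = Quaternion.normSq (u₀ + c • w) := by rw [Quaternion.normSq_eq_norm_mul_self, sq]
      rw [e, Quaternion.normSq_def', ← hfootI]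
      nlinarith [sq_nonneg (u₀ + c • w).re, sq_nonneg (u₀ + c • w).imJ, sq_nonneg (u₀ + c • w).imK]
    exact (pow_le_pow_iff_left₀ hn.le (norm_nonneg _) two_ne_zero).1 h1
  have hfoot : u₀ + c • w ≠ 0 := fun h0 => by
    have : (u₀ + c • w).imI = 0 := by rw [h0]; rfl
    rw [hfootI] at this
    exact hn.ne' this
  have h := jet4_radialUnit_line (u₀ := u₀) (w := w) hfoot
  -- the size `‖w‖/‖foot‖ ≤ |δ₁|/‖im a‖`
  have hwn : ‖w‖ = |δ₁| := by rw [hw, norm_smul, norm_one, mul_one, Real.norm_eq_abs, abs_neg]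
  have hsize : ‖w‖ / ‖u₀ + c • w‖ ≤ |δ₁| / ‖a.im‖ := by
    rw [hwn]; exact div_le_div_of_nonneg_left (abs_nonneg _) hn hfoot_norm
  have h' := jet4_mono (by positivity) hsize h
  simpa only [eline] using h'

/-! ## §2 Leaders and followers along the joint line -/

omit [NeZero L] in
/-- ★★ **LEADER JETS ALONG A JOINT HUB–LETTER LINE**: for `im a ≠ 0`, every leader of `blowUpPoint 1 (gnomonicPoint (a − (sδ₁)·1) ε (η + s • ξ))` carries, as a
function of `s`, a 4-jet of size `2|δ₁|∕‖im a‖ + √Σ(ξ.1.1)ₖ² + √Σ(ξ.1.2)ₖ² + √Σ(ξ.2.1)ₖ²`. [folklore] -/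
theorem jet4_leader_hubLine {a : ℍ} (ha : a.im ≠ 0) (δ₁ : ℝ) (ε : BlowUpRing.GnoSign L) (η ξ : BlowUpRing.GnoCoord L) (μ : Fin 4) :
    ∃ f₁ f₂ f₃ f₄ : ℝ → ℍ,
      (∀ s, HasDerivAt (fun s : ℝ => su2Quat ((BlowUpRing.blowUpPoint (L := L) 1 (BlowUpRing.gnomonicPoint (a - (s * δ₁) • (1 : ℍ)) ε (η + s • ξ))).1 μ)) (f₁ s) s) ∧
      (∀ s, HasDerivAt f₁ (f₂ s) s) ∧ (∀ s, HasDerivAt f₂ (f₃ s) s) ∧ (∀ s, HasDerivAt f₃ (f₄ s) s) ∧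
      ∀ s, ‖su2Quat ((BlowUpRing.blowUpPoint (L := L) 1 (BlowUpRing.gnomonicPoint (a - (s * δ₁) • (1 : ℍ)) ε (η + s • ξ))).1 μ)‖ ≤ 1 ∧
        ‖f₁ s‖ ≤ 2 * (|δ₁| / ‖a.im‖) + Real.sqrt (∑ k, ξ.1.1 k ^ 2) + Real.sqrt (∑ k, ξ.1.2 k ^ 2) + Real.sqrt (∑ k, ξ.2.1 k ^ 2) ∧
        ‖f₂ s‖ ≤ (2 * (|δ₁| / ‖a.im‖) + Real.sqrt (∑ k, ξ.1.1 k ^ 2) + Real.sqrt (∑ k, ξ.1.2 k ^ 2) + Real.sqrt (∑ k, ξ.2.1 k ^ 2)) ^ 2 ∧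
        ‖f₃ s‖ ≤ 3 * (2 * (|δ₁| / ‖a.im‖) + Real.sqrt (∑ k, ξ.1.1 k ^ 2) + Real.sqrt (∑ k, ξ.1.2 k ^ 2) + Real.sqrt (∑ k, ξ.2.1 k ^ 2)) ^ 3 ∧
        ‖f₄ s‖ ≤ 9 * (2 * (|δ₁| / ‖a.im‖) + Real.sqrt (∑ k, ξ.1.1 k ^ 2) + Real.sqrt (∑ k, ξ.1.2 k ^ 2) + Real.sqrt (∑ k, ξ.2.1 k ^ 2)) ^ 4 := by
  have hH : 0 ≤ |δ₁| / ‖a.im‖ := by positivity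
  have hx : 0 ≤ Real.sqrt (∑ k, ξ.1.1 k ^ 2) := Real.sqrt_nonneg _
  have hy : 0 ≤ Real.sqrt (∑ k, ξ.1.2 k ^ 2) := Real.sqrt_nonneg _
  have hz : 0 ≤ Real.sqrt (∑ k, ξ.2.1 k ^ 2) := Real.sqrt_nonneg _
  have ha0 : ∀ s : ℝ, a - (s * δ₁) • (1 : ℍ) ≠ 0 := fun s => sub_smul_one_ne_zero ha _
  match μ with
  | ⟨0, _⟩ =>
    have e : ∀ s : ℝ, su2Quat (quatToSU2 (gnoLetter ε.1.1 (η.1.1 + s • ξ.1.1))) =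
        su2Quat ((BlowUpRing.blowUpPoint (L := L) 1 (BlowUpRing.gnomonicPoint (a - (s * δ₁) • (1 : ℍ)) ε (η + s • ξ))).1 ⟨0, by omega⟩) := fun s => by
      show _ = su2Quat (leaderTuple (a - (s * δ₁) • (1 : ℍ)) (dil3 1 (BlowUpRing.gnomonicPoint (a - (s * δ₁) • (1 : ℍ)) ε (η + s • ξ)).2.1) 0)
      rw [(BlowUp.leaderTuple_apply _ _).1, dil3_one']; rfl
    have h := jet4_mono hx (show _ ≤ 2 * (|δ₁| / ‖a.im‖) + Real.sqrt (∑ k, ξ.1.1 k ^ 2) + Real.sqrt (∑ k, ξ.1.2 k ^ 2) + Real.sqrt (∑ k, ξ.2.1 k ^ 2) by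
      linarith) (jet4_gnoLetterLine ε.1.1 η.1.1 ξ.1.1)
    simpa only [e] using h
  | ⟨1, _⟩ =>
    -- the slaved letter `Ā(s)·x̂(s)·A(s)·ẑ(s)` with the MOVING hub unit `A(s)`
    have hA := jet4_hubAxis_line ha δ₁
    have h3 := jet4_mul (by positivity) hz
      (jet4_mul (by positivity) hH (jet4_mul hH hx (jet4_star hA) (jet4_gnoLetterLine ε.1.1 η.1.1 ξ.1.1)) hA)
      (jet4_gnoLetterLine ε.2.1 η.2.1 ξ.2.1)
    have e : ∀ s : ℝ, star (radialUnit (axisPoint (a - (s * δ₁) • (1 : ℍ)))) * su2Quat (quatToSU2 (gnoLetter ε.1.1 (η.1.1 + s • ξ.1.1))) *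
        radialUnit (axisPoint (a - (s * δ₁) • (1 : ℍ))) * su2Quat (quatToSU2 (gnoLetter ε.2.1 (η.2.1 + s • ξ.2.1))) =
        su2Quat ((BlowUpRing.blowUpPoint (L := L) 1 (BlowUpRing.gnomonicPoint (a - (s * δ₁) • (1 : ℍ)) ε (η + s • ξ))).1 ⟨1, by omega⟩) := fun s => by
      rw [← su2Quat_quatToSU2_slaveP_mul (norm_axisUnit (ha0 s)) (gnoLetter_ne_zero _ _) (gnoLetter_ne_zero _ _)]
      show _ = su2Quat (leaderTuple (a - (s * δ₁) • (1 : ℍ)) (dil3 1 (BlowUpRing.gnomonicPoint (a - (s * δ₁) • (1 : ℍ)) ε (η + s • ξ)).2.1) 1)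
      rw [(BlowUp.leaderTuple_apply _ _).2.1, dil3_one']; rfl
    have h := jet4_mono (by positivity) (show |δ₁| / ‖a.im‖ + Real.sqrt (∑ k, ξ.1.1 k ^ 2) + |δ₁| / ‖a.im‖ + Real.sqrt (∑ k, ξ.2.1 k ^ 2) ≤
        2 * (|δ₁| / ‖a.im‖) + Real.sqrt (∑ k, ξ.1.1 k ^ 2) + Real.sqrt (∑ k, ξ.1.2 k ^ 2) + Real.sqrt (∑ k, ξ.2.1 k ^ 2) by linarith) h3
    simpa only [e] using h
  | ⟨2, _⟩ =>
    have e : ∀ s : ℝ, su2Quat (quatToSU2 (gnoLetter ε.1.2 (η.1.2 + s • ξ.1.2))) =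
        su2Quat ((BlowUpRing.blowUpPoint (L := L) 1 (BlowUpRing.gnomonicPoint (a - (s * δ₁) • (1 : ℍ)) ε (η + s • ξ))).1 ⟨2, by omega⟩) := fun s => by
      show _ = su2Quat (leaderTuple (a - (s * δ₁) • (1 : ℍ)) (dil3 1 (BlowUpRing.gnomonicPoint (a - (s * δ₁) • (1 : ℍ)) ε (η + s • ξ)).2.1) 2)
      rw [(BlowUp.leaderTuple_apply _ _).2.2.1, dil3_one']; rfl
    have h := jet4_mono hy (show _ ≤ 2 * (|δ₁| / ‖a.im‖) + Real.sqrt (∑ k, ξ.1.1 k ^ 2) + Real.sqrt (∑ k, ξ.1.2 k ^ 2) + Real.sqrt (∑ k, ξ.2.1 k ^ 2) by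
      linarith) (jet4_gnoLetterLine ε.1.2 η.1.2 ξ.1.2)
    simpa only [e] using h
  | ⟨3, _⟩ =>
    have e : ∀ s : ℝ, radialUnit (axisPoint (a - (s * δ₁) • (1 : ℍ))) =
        su2Quat ((BlowUpRing.blowUpPoint (L := L) 1 (BlowUpRing.gnomonicPoint (a - (s * δ₁) • (1 : ℍ)) ε (η + s • ξ))).1 ⟨3, by omega⟩) := fun s => by
      show _ = su2Quat (leaderTuple (a - (s * δ₁) • (1 : ℍ)) (dil3 1 (BlowUpRing.gnomonicPoint (a - (s * δ₁) • (1 : ℍ)) ε (η + s • ξ)).2.1) 3)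
      rw [(BlowUp.leaderTuple_apply _ _).2.2.2]; exact (su2Quat_quatToSU2_axisUnit (ha0 s)).symm
    have h := jet4_mono hH (show |δ₁| / ‖a.im‖ ≤ 2 * (|δ₁| / ‖a.im‖) + Real.sqrt (∑ k, ξ.1.1 k ^ 2) + Real.sqrt (∑ k, ξ.1.2 k ^ 2) + Real.sqrt (∑ k, ξ.2.1 k ^ 2) by
      linarith) (jet4_hubAxis_line ha δ₁)
    simpa only [e] using h

omit [NeZero L] in
/-- ★ **FOLLOWER JETS ALONG A JOINT HUB–LETTER LINE** (the followers do not see the hub): size `√Σ(ξ.2.2 i)ₖ²`. [folklore] -/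
theorem jet4_follower_hubLine (a : ℍ) (δ₁ : ℝ) (ε : BlowUpRing.GnoSign L) (η ξ : BlowUpRing.GnoCoord L) (i : BlowUpRing.Fol L) :
    ∃ f₁ f₂ f₃ f₄ : ℝ → ℍ,
      (∀ s, HasDerivAt (fun s : ℝ => su2Quat ((BlowUpRing.blowUpPoint (L := L) 1 (BlowUpRing.gnomonicPoint (a - (s * δ₁) • (1 : ℍ)) ε (η + s • ξ))).2 i)) (f₁ s) s) ∧
      (∀ s, HasDerivAt f₁ (f₂ s) s) ∧ (∀ s, HasDerivAt f₂ (f₃ s) s) ∧ (∀ s, HasDerivAt f₃ (f₄ s) s) ∧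
      ∀ s, ‖su2Quat ((BlowUpRing.blowUpPoint (L := L) 1 (BlowUpRing.gnomonicPoint (a - (s * δ₁) • (1 : ℍ)) ε (η + s • ξ))).2 i)‖ ≤ 1 ∧
        ‖f₁ s‖ ≤ Real.sqrt (∑ k, ξ.2.2 i k ^ 2) ∧ ‖f₂ s‖ ≤ Real.sqrt (∑ k, ξ.2.2 i k ^ 2) ^ 2 ∧ ‖f₃ s‖ ≤ 3 * Real.sqrt (∑ k, ξ.2.2 i k ^ 2) ^ 3 ∧
        ‖f₄ s‖ ≤ 9 * Real.sqrt (∑ k, ξ.2.2 i k ^ 2) ^ 4 := by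
  have e : ∀ s : ℝ, su2Quat (quatToSU2 (gnoLetter (ε.2.2 i) (η.2.2 i + s • ξ.2.2 i))) =
      su2Quat ((BlowUpRing.blowUpPoint (L := L) 1 (BlowUpRing.gnomonicPoint (a - (s * δ₁) • (1 : ℍ)) ε (η + s • ξ))).2 i) := fun s => by
    show _ = su2Quat (quatToSU2 (ZeroModeSigma.dilateIm 1 (gnoLetter (ε.2.2 i) ((η + s • ξ).2.2 i))))
    rw [dilateIm_one_apply]; rfl
  have h := jet4_gnoLetterLine (ε.2.2 i) (η.2.2 i) (ξ.2.2 i)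
  simpa only [e] using h

/-! ## §3 The joint 4-jet of the deficit and its Taylor data -/

set_option maxHeartbeats 400000 in
/-- ★★ **FOUR DERIVATIVE WITNESSES OF `s ↦ F̂_{a − (sδ₁)·1, ε}(η + s·ξ)`**, bounded by `1008L⁴S`, `39984L⁴S²`, `6816096L⁴S³`, `1464571584L⁴S⁴` when `|δ₁| ≤ S·‖im a‖`
and all letter sizes of `ξ` are `≤ S` (leaders `≤ 5S`, followers `≤ S`, words `≤ 7S`; ✓`jet4_fixHistory`, ✓`realJet4_qDeficit_le`). [cite: Luscher1983, §2] -/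
theorem realJet4_gnoDeficit_hubLine_le (z : Fin 3 → Bool) (χ : Site 3 L → SU2) {a : ℍ} (ha : a.im ≠ 0) (δ₁ : ℝ) (ε : GnoSign L) (η ξ : GnoCoord L) {S : ℝ}
    (hS : 0 ≤ S) (hδ : |δ₁| ≤ S * ‖a.im‖) (hx : Real.sqrt (∑ k, ξ.1.1 k ^ 2) ≤ S) (hy : Real.sqrt (∑ k, ξ.1.2 k ^ 2) ≤ S) (hz : Real.sqrt (∑ k, ξ.2.1 k ^ 2) ≤ S)
    (hf : ∀ i, Real.sqrt (∑ k, ξ.2.2 i k ^ 2) ≤ S) :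
    ∃ d₁ d₂ d₃ d₄ : ℝ → ℝ, (∀ s, HasDerivAt (fun s : ℝ => gnoDeficit z χ (a - (s * δ₁) • (1 : ℍ)) ε (η + s • ξ)) (d₁ s) s) ∧
      (∀ s, HasDerivAt d₁ (d₂ s) s) ∧ (∀ s, HasDerivAt d₂ (d₃ s) s) ∧ (∀ s, HasDerivAt d₃ (d₄ s) s) ∧
      ∀ s, |d₁ s| ≤ 1008 * (L : ℝ) ^ 4 * S ∧ |d₂ s| ≤ 39984 * (L : ℝ) ^ 4 * S ^ 2 ∧ |d₃ s| ≤ 6816096 * (L : ℝ) ^ 4 * S ^ 3 ∧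
        |d₄ s| ≤ 1464571584 * (L : ℝ) ^ 4 * S ^ 4 := by
  have hn : 0 < ‖a.im‖ := norm_pos_iff.2 ha
  have hH : |δ₁| / ‖a.im‖ ≤ S := by rw [div_le_iff₀ hn]; exact hδ
  -- the letters: leaders `≤ 5S`, followers `≤ S`
  have hC : ∀ μ : Fin 4, ∃ f₁ f₂ f₃ f₄ : ℝ → ℍ,
      (∀ s, HasDerivAt (fun s : ℝ => su2Quat ((blowUpPoint (L := L) 1 (gnomonicPoint (a - (s * δ₁) • (1 : ℍ)) ε (η + s • ξ))).1 μ)) (f₁ s) s) ∧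
      (∀ s, HasDerivAt f₁ (f₂ s) s) ∧ (∀ s, HasDerivAt f₂ (f₃ s) s) ∧ (∀ s, HasDerivAt f₃ (f₄ s) s) ∧
      ∀ s, ‖su2Quat ((blowUpPoint (L := L) 1 (gnomonicPoint (a - (s * δ₁) • (1 : ℍ)) ε (η + s • ξ))).1 μ)‖ ≤ 1 ∧ ‖f₁ s‖ ≤ 5 * S ∧ ‖f₂ s‖ ≤ (5 * S) ^ 2 ∧
        ‖f₃ s‖ ≤ 3 * (5 * S) ^ 3 ∧ ‖f₄ s‖ ≤ 9 * (5 * S) ^ 4 :=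
    fun μ => jet4_mono (by positivity) (by linarith) (jet4_leader_hubLine ha δ₁ ε η ξ μ)
  have hU : ∀ i : Fol L, ∃ f₁ f₂ f₃ f₄ : ℝ → ℍ,
      (∀ s, HasDerivAt (fun s : ℝ => su2Quat ((blowUpPoint (L := L) 1 (gnomonicPoint (a - (s * δ₁) • (1 : ℍ)) ε (η + s • ξ))).2 i)) (f₁ s) s) ∧
      (∀ s, HasDerivAt f₁ (f₂ s) s) ∧ (∀ s, HasDerivAt f₂ (f₃ s) s) ∧ (∀ s, HasDerivAt f₃ (f₄ s) s) ∧
      ∀ s, ‖su2Quat ((blowUpPoint (L := L) 1 (gnomonicPoint (a - (s * δ₁) • (1 : ℍ)) ε (η + s • ξ))).2 i)‖ ≤ 1 ∧ ‖f₁ s‖ ≤ S ∧ ‖f₂ s‖ ≤ S ^ 2 ∧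
        ‖f₃ s‖ ≤ 3 * S ^ 3 ∧ ‖f₄ s‖ ≤ 9 * S ^ 4 :=
    fun i => jet4_mono (Real.sqrt_nonneg _) (hf i) (jet4_follower_hubLine a δ₁ ε η ξ i)
  -- the words and the deficit
  obtain ⟨hl, hs⟩ := jet4_fixHistory (C := fun s => (blowUpPoint (L := L) 1 (gnomonicPoint (a - (s * δ₁) • (1 : ℍ)) ε (η + s • ξ))).1)
    (U := fun s => (blowUpPoint (L := L) 1 (gnomonicPoint (a - (s * δ₁) • (1 : ℍ)) ε (η + s • ξ))).2) χ (by positivity : (0 : ℝ) ≤ 5 * S) hS hC hU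
  have e7 : 5 * S + S + S = 7 * S := by ring
  rw [e7] at hl hs
  have h := realJet4_qDeficit_le (L := L) z (M := 7 * S) (by positivity)
    (Q := fun s => ((fun (i : Fin (2 * L - 1 + 1)) (e : Edge 3 L) =>
        su2Quat ((fixHistory (ringConfig χ (blowUpPoint (L := L) 1 (gnomonicPoint (a - (s * δ₁) • (1 : ℍ)) ε (η + s • ξ))))).1 i e)),
      fun x : Site 3 L => su2Quat ((fixHistory (ringConfig χ (blowUpPoint (L := L) 1 (gnomonicPoint (a - (s * δ₁) • (1 : ℍ)) ε (η + s • ξ))))).2 x)))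
    (fun i e => hl i e) (fun x => hs x)
  have e : (fun s : ℝ => gnoDeficit z χ (a - (s * δ₁) • (1 : ℍ)) ε (η + s • ξ)) = fun s => qDeficit z
      ((fun (i : Fin (2 * L - 1 + 1)) (e : Edge 3 L) =>
          su2Quat ((fixHistory (ringConfig χ (blowUpPoint (L := L) 1 (gnomonicPoint (a - (s * δ₁) • (1 : ℍ)) ε (η + s • ξ))))).1 i e)),
        fun x : Site 3 L => su2Quat ((fixHistory (ringConfig χ (blowUpPoint (L := L) 1 (gnomonicPoint (a - (s * δ₁) • (1 : ℍ)) ε (η + s • ξ))))).2 x)) :=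
    funext fun s => swapRingDeficit_eq_qDeficit z _
  rw [e]
  refine realJet4_mono ?_ ?_ ?_ ?_ h
  · nlinarith [pow_nonneg (Nat.cast_nonneg L : (0 : ℝ) ≤ L) 4]
  · nlinarith [pow_nonneg (Nat.cast_nonneg L : (0 : ℝ) ≤ L) 4, sq_nonneg S]
  · nlinarith [pow_nonneg (Nat.cast_nonneg L : (0 : ℝ) ≤ L) 4, pow_nonneg hS 3]
  · nlinarith [pow_nonneg (Nat.cast_nonneg L : (0 : ℝ) ≤ L) 4, pow_nonneg hS 4]

/-- ★★★ **THE σ-GLUED DEFICIT IS `C⁴`-BOUNDED ALONG JOINT HUB–LETTER LINES** (Taylor data for the B-tube and sector-001 fibres, which contain the hub direction):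
for `im a ≠ 0`, signs `ε`, base point `η`, direction `ξ` with letter sizes `≤ S`, hub speed `|δ₁| ≤ S·‖im a‖`, and `ψ s = gnoDeficit z χ (a − (sδ₁)·1) ε (η + s • ξ)`:
`|ψ′| ≤ 1008L⁴S`, `|ψ″| ≤ 39984L⁴S²`, `|ψ‴| ≤ 6816096L⁴S³`, `|ψ⁗| ≤ 1464571584L⁴S⁴` EVERYWHERE, and at `s = 0`
`|ψ 1 − ψ 0 − ψ′ 0 − ψ″ 0∕2| ≤ 6816096L⁴S³∕2`, `|ψ 1 − ψ 0 − ψ′ 0 − ψ″ 0∕2 − ψ‴ 0∕6| ≤ 1464571584L⁴S⁴∕6`. [cite: Luscher1983, §2] -/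
theorem taylor_four_gnoDeficit_hubLine (z : Fin 3 → Bool) (χ : Site 3 L → SU2) {a : ℍ} (ha : a.im ≠ 0) (δ₁ : ℝ) (ε : GnoSign L) (η ξ : GnoCoord L) {S : ℝ}
    (hS : 0 ≤ S) (hδ : |δ₁| ≤ S * ‖a.im‖) (hx : Real.sqrt (∑ k, ξ.1.1 k ^ 2) ≤ S) (hy : Real.sqrt (∑ k, ξ.1.2 k ^ 2) ≤ S) (hz : Real.sqrt (∑ k, ξ.2.1 k ^ 2) ≤ S)
    (hf : ∀ i, Real.sqrt (∑ k, ξ.2.2 i k ^ 2) ≤ S) :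
    (∀ s, |deriv (fun s : ℝ => gnoDeficit z χ (a - (s * δ₁) • (1 : ℍ)) ε (η + s • ξ)) s| ≤ 1008 * (L : ℝ) ^ 4 * S ∧
        |iteratedDeriv 2 (fun s : ℝ => gnoDeficit z χ (a - (s * δ₁) • (1 : ℍ)) ε (η + s • ξ)) s| ≤ 39984 * (L : ℝ) ^ 4 * S ^ 2 ∧
        |iteratedDeriv 3 (fun s : ℝ => gnoDeficit z χ (a - (s * δ₁) • (1 : ℍ)) ε (η + s • ξ)) s| ≤ 6816096 * (L : ℝ) ^ 4 * S ^ 3 ∧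
        |iteratedDeriv 4 (fun s : ℝ => gnoDeficit z χ (a - (s * δ₁) • (1 : ℍ)) ε (η + s • ξ)) s| ≤ 1464571584 * (L : ℝ) ^ 4 * S ^ 4) ∧
      |gnoDeficit z χ (a - δ₁ • (1 : ℍ)) ε (η + ξ) - gnoDeficit z χ a ε η - deriv (fun s : ℝ => gnoDeficit z χ (a - (s * δ₁) • (1 : ℍ)) ε (η + s • ξ)) 0 -
          iteratedDeriv 2 (fun s : ℝ => gnoDeficit z χ (a - (s * δ₁) • (1 : ℍ)) ε (η + s • ξ)) 0 / 2| ≤ 6816096 * (L : ℝ) ^ 4 * S ^ 3 / 2 ∧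
      |gnoDeficit z χ (a - δ₁ • (1 : ℍ)) ε (η + ξ) - gnoDeficit z χ a ε η - deriv (fun s : ℝ => gnoDeficit z χ (a - (s * δ₁) • (1 : ℍ)) ε (η + s • ξ)) 0 -
          iteratedDeriv 2 (fun s : ℝ => gnoDeficit z χ (a - (s * δ₁) • (1 : ℍ)) ε (η + s • ξ)) 0 / 2 -
          iteratedDeriv 3 (fun s : ℝ => gnoDeficit z χ (a - (s * δ₁) • (1 : ℍ)) ε (η + s • ξ)) 0 / 6| ≤ 1464571584 * (L : ℝ) ^ 4 * S ^ 4 / 6 := by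
  obtain ⟨d₁, d₂, d₃, d₄, h₁, h₂, h₃, h₄, hb⟩ := realJet4_gnoDeficit_hubLine_le z χ ha δ₁ ε η ξ hS hδ hx hy hz hf
  obtain ⟨e1, e2, e3, e4⟩ := iteratedDeriv_eq_of_hasDerivAt_chain h₁ h₂ h₃ h₄
  have e1' : gnoDeficit z χ (a - δ₁ • (1 : ℍ)) ε (η + ξ) = (fun s : ℝ => gnoDeficit z χ (a - (s * δ₁) • (1 : ℍ)) ε (η + s • ξ)) 1 := by
    simp only [one_smul, one_mul]
  have e0' : gnoDeficit z χ a ε η = (fun s : ℝ => gnoDeficit z χ (a - (s * δ₁) • (1 : ℍ)) ε (η + s • ξ)) 0 := by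
    simp only [zero_smul, add_zero, zero_mul, sub_zero]
  refine ⟨fun s => ?_, ?_, ?_⟩
  · rw [e1, e2, e3, e4]; exact hb s
  · rw [e1, e2, e1', e0']
    exact abs_taylor_three_remainder_le h₁ h₂ h₃ (fun s _ => (hb s).2.2.1)
  · rw [e1, e2, e3, e1', e0']
    exact abs_taylor_four_remainder_le h₁ h₂ h₃ h₄ (fun s _ => (hb s).2.2.2)

end Summit.QuantumFields.YangMills.Theorems.SwapVirialDeficit.Gnomonic

end
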